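/-
Copyright (c) 2026 the pub-hodgecm-mathlib formalisation cell (harness21).  Prover seat hodgecm-mathlib-K2Liu-p09 (g4): Track B «K2-LIT», #184♮ = hLiu418,
Road I organ (A-int)-fin, DEFS brick (β-1) (K2E5-plan (g5) RULING (β) 07:08:32Z; LEAD F0P6-plan (g12) 07:10:57Z «=» ×3; heads
`K2/K2Liu-p09/g4/HEADS-DAprime-beta1.K2Liu-p09-g4.md`).
-/
import Literature.NumberTheory.GelbartRogawski1991.LocalUnitarySplittingDatum        -- ★ `localGram`, `localPairing`, `localSchrodinger`, `LocalMp`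
import Literature.NumberTheory.GelbartRogawski1991.DoubledUnitaryGlobalSplittingData   -- ★ `gramR`, `gramD`, `hermD`, `e₂` (GRConstruction)
import Literature.RepresentationTheory.HeisenbergGroup.DoubledDeltaSymplecticTransport  -- ★ `deltaGram`, `deltaCoords`, `deltaHeisenbergEquiv`, `deltaSymplecticTransport`
import Literature.RepresentationTheory.HeisenbergGroup.MpPsiIntertwinerCongr           -- ★ `MpPsi.congr` (functoriality of `S̃p_ψ` in (Φ, T, φ))
import HarnessLib

/-!
# Crux `HLiu418`, Track B road `K2_Liu`, Road I organ (A-int)-fin — DEFS brick (β-1): THE DOUBLING-POLARISED LOCAL SCHRÖDINGER MODEL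
# of a doubled CM datum at a finite place (`ℓ_Δ`-adapted coordinates)

Cell `hodgecm-mathlib`, crux item hLiu418 = `stmt-HodgeConjecture-24832`, route of record `HCCMUnconditional`; squad K2 ∕ K2Liu, prover K2Liu-p09 (g4);
definition lane, `--supports stmt-HodgeConjecture-24832 --as helper`.  DEFINITIONS WITH BODIES + unfolding theorems; no instance, no notation, no
named fact, no `sorry`.  GENERIC in the doubled CM datum `(L, e, dV, dW)` (the Road I big datum `𝔻 ⊗ V′` is the instance `e := e'`, `dW := tensorFrame dW eW dV'`).

The tree's local Schrödinger model ★ `localSchrodinger L⁺ (n+n) (gramD …) v` of the doubled group lives on `𝒮(L⁺_v^{n+n})` in the CM∕REAL-PART polarisation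
(`𝕎_v = L⁺_vᴺ × L⁺_vᴺ`, Lagrangian ★ `lagrangianY`), on which neither `U(V′)` nor `M_Δ` acts geometrically.  The `ℓ_Δ`-ADAPTED polarisation of the SAME
symplectic carrier is ★ in tree (`RepresentationTheory/HeisenbergGroup/DoubledDeltaPolarisation`, `…/DoubledDeltaSymplecticTransport`: `deltaGram`,
`deltaCoords`, `deltaHeisenbergEquiv`, `deltaSymplecticTransport`), written for a doubled Gram `T = reindex e (T₀ ⊕ (−T₀))` over any `K ∋ ⅟2`.  This file
instantiates it at `K := L⁺_v`, `T₀ := gramR ⊗ L⁺_v`, `e := e₂`: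
* §1 `gramRLoc`, `localGram_gramD_eq` (the local doubled Gram IS `reindex e₂ (T₀,v ⊕ (−T₀,v))`), `deltaGramLoc := deltaGram e₂ T₀,v`;
* §2 **`localSchrodingerDelta v`** — the smooth Schrödinger model ★ `schrodingerSB` of `H(𝕎_v)` at the pairing of `deltaGramLoc v` on
  `𝒮(L⁺_v^{n+n}) = 𝒮(X_Δ)`, `X_Δ = Res_{L∕L⁺} ℓ_∇ ≅ Res(V ⊗ W)_v` — the DOUBLING-POLARISED MODEL (the `Δ`-functional is evaluation at `0`, `M_Δ` and the partner
  group act linearly); `LocalMpDelta` its metaplectic group of pairs;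
* §3 **`deltaHeisenbergEquivLoc v : H(polar β_{T_v}) ≃* H(polar β_{J_Δ,v})`**, **`deltaSpTransportLoc v : Sp ≃* Sp`** — the ★ transports at `v` — and their
  compatibility (C) with Weil's sections `deltaHeisenbergEquivLoc_ofSymplectic_act`;
* §4 HYPOTHESIS-FIRST in an intertwiner `Γ_v` (`IsDeltaIntertwiner`): **`mpTransportLoc Γ hΓ : LocalMp ≃* LocalMpDelta`** (★ `MpPsi.congr`), `coe_`, `proj_…_comp`,
  `toRep_mpTransportLoc_apply(')` (`ω^Δ(Γ_* p) Γ = Γ ω(p)`);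
* §5 HYPOTHESIS-FIRST in a splitting `s^Δ`: **`swSectionDelta sΔ Φ h := (ω^Δ(s^Δ h) Φ)(0)`** (`_apply/_add/_smul/_zero/_mul_right`) and the transport identity
  `swSectionDelta_transport_apply : f^Δ_{Γ Φ}(h) = (Γ (ω_s(h) Φ))(0)` for `s^Δ := mpTransportLoc Γ ∘ s`.
NOT here: the PRODUCTION of `Γ_v` (partial Fourier transform along `deltaCoords`; (β-3), REPORT-FIRST) and the Kudla–Rallis map `r_w` ((β-2)).

HONEST LABEL: HC_CM is proved only modulo the printed citations (2 remaining named inputs: hLiu418 = stmt-HodgeConjecture-24832,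
h413 = stmt-HodgeConjecture-24833) until rung 0 closes; this file defines carriers and closes no item.
References: [MoeglinVignerasWaldspurger1987] Chap. 2 I.4, I.7, II.1, II.6; [Kudla1994] §2, §3 Thm. 3.1; [Weil1964] n° 5, n° 34; [KudlaRallis1994] §1.
-/

set_option autoImplicit false
set_option linter.dupNamespace false

noncomputable section

open scoped Matrix
open NumberField IsDedekindDomain Matrix
open Literature.RepresentationTheory.HeisenbergGroup
open Literature.NumberTheory.Automorphic Literature.NumberTheory.Weil1964
open Literature.NumberTheory.GelbartRogawski1991 Literature.NumberTheory.GelbartRogawski1991.GRConstruction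
open Literature.NumberTheory.GelbartRogawski1991.UnitaryDualPair.LocalSplitting

namespace Summit.HodgeConjecture.HodgeConjecture.Cruxes.HLiu418.K2LiuDoublingSchrodingerModelDefs

variable (L : Type) [Field L] [NumberField L] [IsCMField L]
variable {N M n : ℕ} (e : Fin N × Fin M ≃ Fin n)
  (dV : Fin N → L) (hdV : ∀ i, IsCMField.complexConj L (dV i) = dV i)
  (dW : Fin M → L) (hdW : ∀ i, IsCMField.complexConj L (dW i) = dW i)

/-! ## §1 The local Gram data -/

/-- `T₀,v := gramR ⊗ L⁺_v ∈ M_n(L⁺_v)` — the undoubled real Gram matrix at `v`. [cite: Kudla1994, §2] -/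
def gramRLoc (v : HeightOneSpectrum (𝓞 (Fp L))) : Matrix (Fin n) (Fin n) (v.adicCompletion (Fp L)) :=
  (gramR L e dV hdV dW hdW).map (algebraMap (Fp L) (v.adicCompletion (Fp L)))

/-- **the local doubled Gram is `reindex e₂ (T₀,v ⊕ (−T₀,v))`** (★ `localGram` of ★ `gramD`, entrywise `map` through `reindex`∕`fromBlocks`).
[cite: Kudla1994, §2 (doubled space)] -/
theorem localGram_gramD_eq (v : HeightOneSpectrum (𝓞 (Fp L))) :
    localGram (Fp L) (n + n) (gramD L e dV hdV dW hdW) v =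
      Matrix.reindex (e₂ (n := n)) (e₂ (n := n)) (Matrix.fromBlocks (gramRLoc L e dV hdV dW hdW v) 0 0 (-(gramRLoc L e dV hdV dW hdW v))) := by
  unfold localGram gramD gramRLoc
  rw [Matrix.reindex_apply, Matrix.reindex_apply, ← Matrix.submatrix_map, Matrix.fromBlocks_map]
  congr 2; ext i j; simp

/-- **the `ℓ_Δ`-adapted local Gram** `J_{Δ,v} := deltaGram e₂ T₀,v = reindex e₂ (0, 2T₀,v; −2T₀,vᵀ, 0)` (★ `deltaGram`). [cite: Kudla1994, §2] -/
def deltaGramLoc (v : HeightOneSpectrum (𝓞 (Fp L))) : Matrix (Fin (n + n)) (Fin (n + n)) (v.adicCompletion (Fp L)) :=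
  deltaGram (e₂ (n := n)) (gramRLoc L e dV hdV dW hdW v)

/-- unfolding. [cite: Kudla1994, §2] -/
theorem deltaGramLoc_eq (v : HeightOneSpectrum (𝓞 (Fp L))) :
    deltaGramLoc L e dV hdV dW hdW v = deltaGram (e₂ (n := n)) (gramRLoc L e dV hdV dW hdW v) :=
  rfl

/-! ## §2 The doubling-polarised local Schrödinger model -/

omit [IsCMField L] in
/-- `x ↦ β_{J_{Δ,v}}(x, y)` is continuous (a linear form on the finite-dimensional `L⁺_vᴺ`). [folklore] -/
theorem continuous_toLinearMap₂'_left {v : HeightOneSpectrum (𝓞 (Fp L))} {ι : Type} [Fintype ι] [DecidableEq ι]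
    (A : Matrix ι ι (v.adicCompletion (Fp L))) (y : ι → v.adicCompletion (Fp L)) :
    Continuous fun u : ι → v.adicCompletion (Fp L) => Matrix.toLinearMap₂' (v.adicCompletion (Fp L)) A u y := by
  simp only [Matrix.toLinearMap₂'_apply', dotProduct]
  exact continuous_finsetSum _ fun i _ => (continuous_apply i).mul continuous_const

/-- **THE DOUBLING-POLARISED LOCAL SCHRÖDINGER MODEL** `ρ^Δ_v` of the Heisenberg group `H(𝕎_v)` read at the `ℓ_Δ`-adapted pairing `β_{J_{Δ,v}}`, on
`𝒮(L⁺_v^{n+n}) = 𝒮(X_Δ)` with `ψ_v = adeleAddCharAt L⁺ v` (★ `schrodingerSB`): `(ρ^Δ((x,y),t) Φ)(u) = ψ_v(t + β_{J_Δ}(u, y)) Φ(u + x)`.  In this model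
the Siegel Levi `M_Δ` and the partner group act LINEARLY and the `Δ`-functional is `Φ ↦ Φ(0)`.
[cite: MoeglinVignerasWaldspurger1987, Chap. 2 I.4 Exemple (1), I.7] [cite: Kudla1994, §3 Thm. 3.1] -/
def localSchrodingerDelta (v : HeightOneSpectrum (𝓞 (Fp L))) :
    Representation ℂ (Heisenberg (polar (Matrix.toLinearMap₂' (v.adicCompletion (Fp L)) (deltaGramLoc L e dV hdV dW hdW v))))
      (SchwartzBruhat (Fin (n + n) → v.adicCompletion (Fp L))) :=
  schrodingerSB (Matrix.toLinearMap₂' (v.adicCompletion (Fp L)) (deltaGramLoc L e dV hdV dW hdW v)) (adeleAddCharAt (Fp L) v)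
    (isLocallyConstant_of_isContinuousNontrivial (isContinuousNontrivial_adeleAddCharAt (Fp L) v))
    (continuous_toLinearMap₂'_left L (deltaGramLoc L e dV hdV dW hdW v))

/-- the local metaplectic group of pairs of the doubling-polarised model. [cite: MoeglinVignerasWaldspurger1987, Chap. 2 II.1 (B)] -/
abbrev LocalMpDelta (v : HeightOneSpectrum (𝓞 (Fp L))) : Type :=
  MpPsi (localSchrodingerDelta L e dV hdV dW hdW v)

/-! ## §3 The transports from the CM model -/

/-- **`H(polar β_{T_v}) ≃* H(polar β_{J_{Δ,v}})`** — ★ `deltaHeisenbergEquiv` at `K := L⁺_v`, `e := e₂`, `T₀ := T₀,v` (`⅟2` from characteristic `0`).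
[cite: MoeglinVignerasWaldspurger1987, Chap. 2 I.7] [cite: Weil1964, n° 5] -/
def deltaHeisenbergEquivLoc (v : HeightOneSpectrum (𝓞 (Fp L))) :
    Heisenberg (polar (localPairing (Fp L) (n + n) (gramD L e dV hdV dW hdW) v)) ≃*
      Heisenberg (polar (Matrix.toLinearMap₂' (v.adicCompletion (Fp L)) (deltaGramLoc L e dV hdV dW hdW v))) :=
  deltaHeisenbergEquiv (e₂ (n := n)) (gramRLoc L e dV hdV dW hdW v) (localGram_gramD_eq L e dV hdV dW hdW v)

/-- **`Sp(polar β_{T_v}) ≃* Sp(polar β_{J_{Δ,v}})`**, `σ ↦ deltaCoords ∘ σ ∘ deltaCoords⁻¹` — ★ `deltaSymplecticTransport` at `v`.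
[cite: MoeglinVignerasWaldspurger1987, Chap. 2 I.7] [cite: Weil1964, n° 34] -/
def deltaSpTransportLoc (v : HeightOneSpectrum (𝓞 (Fp L))) :
    LocalSp (Fp L) (n + n) (gramD L e dV hdV dW hdW) v ≃*
      symplecticGroup (polar (Matrix.toLinearMap₂' (v.adicCompletion (Fp L)) (deltaGramLoc L e dV hdV dW hdW v))) :=
  deltaSymplecticTransport (e₂ (n := n)) (gramRLoc L e dV hdV dW hdW v) (localGram_gramD_eq L e dV hdV dW hdW v)

/-- **compatibility (C) of the two transports with Weil's sections**: `Φ_Δ((σ)·h) = (deltaSpTransportLoc σ)·Φ_Δ(h)` (★ `deltaHeisenbergEquiv_ofSymplectic_act`).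
[cite: Weil1964, n° 5, p. 150] [cite: MoeglinVignerasWaldspurger1987, Chap. 2 I.7] -/
theorem deltaHeisenbergEquivLoc_ofSymplectic_act (v : HeightOneSpectrum (𝓞 (Fp L))) (σ : LocalSp (Fp L) (n + n) (gramD L e dV hdV dW hdW) v)
    (h : Heisenberg (polar (localPairing (Fp L) (n + n) (gramD L e dV hdV dW hdW) v))) :
    deltaHeisenbergEquivLoc L e dV hdV dW hdW v ((ofSymplectic _ σ).act h) =
      (ofSymplectic _ (deltaSpTransportLoc L e dV hdV dW hdW v σ)).act (deltaHeisenbergEquivLoc L e dV hdV dW hdW v h) :=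
  deltaHeisenbergEquiv_ofSymplectic_act (e₂ (n := n)) (gramRLoc L e dV hdV dW hdW v) (localGram_gramD_eq L e dV hdV dW hdW v) σ h

/-! ## §4 Transport of the metaplectic groups of pairs along an intertwiner `Γ_v` (HYPOTHESIS-FIRST in `Γ_v`) -/

/-- **`Γ_v` intertwines the CM model with the doubling-polarised model along `Φ_Δ`**: `Γ (ρ_v(h) Φ) = ρ^Δ_v(Φ_Δ h) (Γ Φ)`.  (Such a `Γ_v` exists and is
unique up to `ℂˣ` by Stone–von Neumann; an explicit one — a partial Fourier transform along `deltaCoords` — is the business of brick (β-3).)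
[cite: MoeglinVignerasWaldspurger1987, Chap. 2 I.7, II Remarque (3)] -/
def IsDeltaIntertwiner (v : HeightOneSpectrum (𝓞 (Fp L)))
    (Γ : SchwartzBruhat (Fin (n + n) → v.adicCompletion (Fp L)) ≃ₗ[ℂ] SchwartzBruhat (Fin (n + n) → v.adicCompletion (Fp L))) : Prop :=
  ∀ (h : Heisenberg (polar (localPairing (Fp L) (n + n) (gramD L e dV hdV dW hdW) v))) (Φ : SchwartzBruhat (Fin (n + n) → v.adicCompletion (Fp L))),
    Γ (localSchrodinger (Fp L) (n + n) (gramD L e dV hdV dW hdW) v h Φ) =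
      localSchrodingerDelta L e dV hdV dW hdW v (deltaHeisenbergEquivLoc L e dV hdV dW hdW v h) (Γ Φ)

/-- **THE TRANSPORT `S̃p_ψ(𝕎_v)[CM model] ≃* S̃p_ψ(𝕎_v)[Δ-model]`** along `(Φ_Δ, Γ_v, deltaSpTransportLoc)`: `(g, M) ↦ (δ g δ⁻¹, Γ M Γ⁻¹)` (★ `MpPsi.congr`).
[cite: MoeglinVignerasWaldspurger1987, Chap. 2 II.1 (A)–(B), II Remarque (3)] -/
def mpTransportLoc (v : HeightOneSpectrum (𝓞 (Fp L)))
    (Γ : SchwartzBruhat (Fin (n + n) → v.adicCompletion (Fp L)) ≃ₗ[ℂ] SchwartzBruhat (Fin (n + n) → v.adicCompletion (Fp L)))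
    (hΓ : IsDeltaIntertwiner L e dV hdV dW hdW v Γ) :
    LocalMp (Fp L) (n + n) (gramD L e dV hdV dW hdW) v ≃* LocalMpDelta L e dV hdV dW hdW v :=
  MpPsi.congr (localSchrodinger (Fp L) (n + n) (gramD L e dV hdV dW hdW) v) (localSchrodingerDelta L e dV hdV dW hdW v)
    (φ := deltaSpTransportLoc L e dV hdV dW hdW v) hΓ (deltaHeisenbergEquivLoc_ofSymplectic_act L e dV hdV dW hdW v)

/-- the underlying pair of `mpTransportLoc Γ (g, M)` is `(deltaSpTransportLoc g, Γ⁻¹ ≫ M ≫ Γ)` (★ `MpPsi.coe_congr`). [cite: MoeglinVignerasWaldspurger1987, Chap. 2 II.1 (B)] -/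
theorem coe_mpTransportLoc (v : HeightOneSpectrum (𝓞 (Fp L)))
    (Γ : SchwartzBruhat (Fin (n + n) → v.adicCompletion (Fp L)) ≃ₗ[ℂ] SchwartzBruhat (Fin (n + n) → v.adicCompletion (Fp L)))
    (hΓ : IsDeltaIntertwiner L e dV hdV dW hdW v Γ) (p : LocalMp (Fp L) (n + n) (gramD L e dV hdV dW hdW) v) :
    ((mpTransportLoc L e dV hdV dW hdW v Γ hΓ p : LocalMpDelta L e dV hdV dW hdW v) :
        symplecticGroup (polar (Matrix.toLinearMap₂' (v.adicCompletion (Fp L)) (deltaGramLoc L e dV hdV dW hdW v))) × (SchwartzBruhat (Fin (n + n) → v.adicCompletion (Fp L)) ≃ₗ[ℂ] SchwartzBruhat (Fin (n + n) → v.adicCompletion (Fp L)))) =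
      (deltaSpTransportLoc L e dV hdV dW hdW v (p : LocalSp (Fp L) (n + n) (gramD L e dV hdV dW hdW) v × (SchwartzBruhat (Fin (n + n) → v.adicCompletion (Fp L)) ≃ₗ[ℂ] SchwartzBruhat (Fin (n + n) → v.adicCompletion (Fp L)))).1,
        Γ.symm ≪≫ₗ (p : LocalSp (Fp L) (n + n) (gramD L e dV hdV dW hdW) v × (SchwartzBruhat (Fin (n + n) → v.adicCompletion (Fp L)) ≃ₗ[ℂ] SchwartzBruhat (Fin (n + n) → v.adicCompletion (Fp L)))).2 ≪≫ₗ Γ) :=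
  rfl

/-- **the transported splitting lies over `deltaSpTransportLoc ∘ (proj ∘ s)`**. [cite: MoeglinVignerasWaldspurger1987, Chap. 2 II.1 (B)] -/
theorem proj_mpTransportLoc_comp (v : HeightOneSpectrum (𝓞 (Fp L)))
    (Γ : SchwartzBruhat (Fin (n + n) → v.adicCompletion (Fp L)) ≃ₗ[ℂ] SchwartzBruhat (Fin (n + n) → v.adicCompletion (Fp L)))
    (hΓ : IsDeltaIntertwiner L e dV hdV dW hdW v Γ) {G : Type} [Group G] (s : G →* LocalMp (Fp L) (n + n) (gramD L e dV hdV dW hdW) v) (g : G) :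
    MpPsi.proj (localSchrodingerDelta L e dV hdV dW hdW v) (((mpTransportLoc L e dV hdV dW hdW v Γ hΓ).toMonoidHom.comp s) g) =
      deltaSpTransportLoc L e dV hdV dW hdW v (MpPsi.proj (localSchrodinger (Fp L) (n + n) (gramD L e dV hdV dW hdW) v) (s g)) :=
  rfl

/-- **`Γ` intertwines the two Weil representations of pairs**: `ω^Δ(mpTransportLoc Γ p) (Γ Φ) = Γ (ω(p) Φ)` (★ `MpPsi.toRep_congr_apply`).
[cite: MoeglinVignerasWaldspurger1987, Chap. 2 I.7] -/
theorem toRep_mpTransportLoc_apply (v : HeightOneSpectrum (𝓞 (Fp L)))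
    (Γ : SchwartzBruhat (Fin (n + n) → v.adicCompletion (Fp L)) ≃ₗ[ℂ] SchwartzBruhat (Fin (n + n) → v.adicCompletion (Fp L)))
    (hΓ : IsDeltaIntertwiner L e dV hdV dW hdW v Γ) (p : LocalMp (Fp L) (n + n) (gramD L e dV hdV dW hdW) v) (Φ : SchwartzBruhat (Fin (n + n) → v.adicCompletion (Fp L))) :
    MpPsi.toRep (localSchrodingerDelta L e dV hdV dW hdW v) (mpTransportLoc L e dV hdV dW hdW v Γ hΓ p) (Γ Φ) =
      Γ (MpPsi.toRep (localSchrodinger (Fp L) (n + n) (gramD L e dV hdV dW hdW) v) p Φ) :=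
  MpPsi.toRep_congr_apply _ _ hΓ (deltaHeisenbergEquivLoc_ofSymplectic_act L e dV hdV dW hdW v) p Φ

/-- the same with `Γ⁻¹` on the other side: `ω^Δ(mpTransportLoc Γ p) Ψ = Γ (ω(p) (Γ⁻¹ Ψ))`. [cite: MoeglinVignerasWaldspurger1987, Chap. 2 I.7] -/
theorem toRep_mpTransportLoc_apply' (v : HeightOneSpectrum (𝓞 (Fp L)))
    (Γ : SchwartzBruhat (Fin (n + n) → v.adicCompletion (Fp L)) ≃ₗ[ℂ] SchwartzBruhat (Fin (n + n) → v.adicCompletion (Fp L)))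
    (hΓ : IsDeltaIntertwiner L e dV hdV dW hdW v Γ) (p : LocalMp (Fp L) (n + n) (gramD L e dV hdV dW hdW) v) (Ψ : SchwartzBruhat (Fin (n + n) → v.adicCompletion (Fp L))) :
    MpPsi.toRep (localSchrodingerDelta L e dV hdV dW hdW v) (mpTransportLoc L e dV hdV dW hdW v Γ hΓ p) Ψ =
      Γ (MpPsi.toRep (localSchrodinger (Fp L) (n + n) (gramD L e dV hdV dW hdW) v) p (Γ.symm Ψ)) :=
  MpPsi.toRep_congr_apply' _ _ hΓ (deltaHeisenbergEquivLoc_ofSymplectic_act L e dV hdV dW hdW v) p Ψ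

/-! ## §5 The Siegel–Weil section in the doubling-polarised model: `f^Δ_Φ(h) = (ω^Δ(s^Δ h) Φ)(0)` (HYPOTHESIS-FIRST in the splitting `s^Δ`) -/

section SW

variable {Nd : ℕ} {J : Matrix (Fin Nd) (Fin Nd) L}

/-- **the Siegel–Weil section of `Φ ∈ 𝒮(X_Δ)` read in the doubling-polarised model**: `f^Δ_Φ(h) := (ω^Δ_v(s^Δ h) Φ)(0)` — the `Δ`-functional IS evaluation
at `0 ∈ X_Δ` here (no Weyl twist), for any splitting `s^Δ : U(J)(L⁺_v) →* S̃p_ψ(𝕎_v)[Δ-model]` (e.g. `mpTransportLoc Γ ∘ s_{𝕍,χ_𝕍,v}`).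
[cite: KudlaRallis1994, §1] [cite: Kudla1994, §3 Thm. 3.1] [cite: Liu2011, §2B] -/
def swSectionDelta (v : HeightOneSpectrum (𝓞 (Fp L)))
    (sΔ : UnitaryGroup.localPi L (IsCMField.complexConj L) Nd J v →* LocalMpDelta L e dV hdV dW hdW v)
    (Φ : SchwartzBruhat (Fin (n + n) → v.adicCompletion (Fp L))) (h : UnitaryGroup.localPi L (IsCMField.complexConj L) Nd J v) : ℂ :=
  ((MpPsi.toRep (localSchrodingerDelta L e dV hdV dW hdW v) (sΔ h) Φ : SchwartzBruhat (Fin (n + n) → v.adicCompletion (Fp L))) :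
    (Fin (n + n) → v.adicCompletion (Fp L)) → ℂ) 0

/-- unfolding. [cite: KudlaRallis1994, §1] -/
theorem swSectionDelta_apply (v : HeightOneSpectrum (𝓞 (Fp L)))
    (sΔ : UnitaryGroup.localPi L (IsCMField.complexConj L) Nd J v →* LocalMpDelta L e dV hdV dW hdW v)
    (Φ : SchwartzBruhat (Fin (n + n) → v.adicCompletion (Fp L))) (h : UnitaryGroup.localPi L (IsCMField.complexConj L) Nd J v) :
    swSectionDelta L e dV hdV dW hdW v sΔ Φ h =
      ((MpPsi.toRep (localSchrodingerDelta L e dV hdV dW hdW v) (sΔ h) Φ : SchwartzBruhat (Fin (n + n) → v.adicCompletion (Fp L))) :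
        (Fin (n + n) → v.adicCompletion (Fp L)) → ℂ) 0 :=
  rfl

/-- `Φ ↦ f^Δ_Φ(h)` is additive. [cite: KudlaRallis1994, §1] -/
theorem swSectionDelta_add (v : HeightOneSpectrum (𝓞 (Fp L)))
    (sΔ : UnitaryGroup.localPi L (IsCMField.complexConj L) Nd J v →* LocalMpDelta L e dV hdV dW hdW v)
    (Φ Ψ : SchwartzBruhat (Fin (n + n) → v.adicCompletion (Fp L))) (h : UnitaryGroup.localPi L (IsCMField.complexConj L) Nd J v) :
    swSectionDelta L e dV hdV dW hdW v sΔ (Φ + Ψ) h = swSectionDelta L e dV hdV dW hdW v sΔ Φ h + swSectionDelta L e dV hdV dW hdW v sΔ Ψ h := by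
  exact (congrArg (fun F : SchwartzBruhat (Fin (n + n) → v.adicCompletion (Fp L)) => (F : (Fin (n + n) → v.adicCompletion (Fp L)) → ℂ) 0)
    ((MpPsi.toRep (localSchrodingerDelta L e dV hdV dW hdW v) (sΔ h)).map_add Φ Ψ)).trans rfl

/-- `Φ ↦ f^Δ_Φ(h)` is homogeneous. [cite: KudlaRallis1994, §1] -/
theorem swSectionDelta_smul (v : HeightOneSpectrum (𝓞 (Fp L)))
    (sΔ : UnitaryGroup.localPi L (IsCMField.complexConj L) Nd J v →* LocalMpDelta L e dV hdV dW hdW v)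
    (a : ℂ) (Φ : SchwartzBruhat (Fin (n + n) → v.adicCompletion (Fp L))) (h : UnitaryGroup.localPi L (IsCMField.complexConj L) Nd J v) :
    swSectionDelta L e dV hdV dW hdW v sΔ (a • Φ) h = a * swSectionDelta L e dV hdV dW hdW v sΔ Φ h := by
  exact (congrArg (fun F : SchwartzBruhat (Fin (n + n) → v.adicCompletion (Fp L)) => (F : (Fin (n + n) → v.adicCompletion (Fp L)) → ℂ) 0)
    ((MpPsi.toRep (localSchrodingerDelta L e dV hdV dW hdW v) (sΔ h)).map_smul a Φ)).trans rfl

/-- `Φ ↦ f^Δ_Φ(h)` kills `0`. [cite: KudlaRallis1994, §1] -/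
theorem swSectionDelta_zero (v : HeightOneSpectrum (𝓞 (Fp L)))
    (sΔ : UnitaryGroup.localPi L (IsCMField.complexConj L) Nd J v →* LocalMpDelta L e dV hdV dW hdW v)
    (h : UnitaryGroup.localPi L (IsCMField.complexConj L) Nd J v) :
    swSectionDelta L e dV hdV dW hdW v sΔ 0 h = 0 := by
  exact (congrArg (fun F : SchwartzBruhat (Fin (n + n) → v.adicCompletion (Fp L)) => (F : (Fin (n + n) → v.adicCompletion (Fp L)) → ℂ) 0)
    (MpPsi.toRep (localSchrodingerDelta L e dV hdV dW hdW v) (sΔ h)).map_zero).trans rfl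

/-- **right translation law `f^Δ_Φ(h k) = f^Δ_{ω^Δ(s^Δ k) Φ}(h)`**. [cite: KudlaRallis1994, §1] [cite: HarrisKudlaSweet1996, §1 (1.8)] -/
theorem swSectionDelta_mul_right (v : HeightOneSpectrum (𝓞 (Fp L)))
    (sΔ : UnitaryGroup.localPi L (IsCMField.complexConj L) Nd J v →* LocalMpDelta L e dV hdV dW hdW v)
    (Φ : SchwartzBruhat (Fin (n + n) → v.adicCompletion (Fp L))) (h k : UnitaryGroup.localPi L (IsCMField.complexConj L) Nd J v) :
    swSectionDelta L e dV hdV dW hdW v sΔ Φ (h * k) =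
      swSectionDelta L e dV hdV dW hdW v sΔ (MpPsi.toRep (localSchrodingerDelta L e dV hdV dW hdW v) (sΔ k) Φ) h := by
  have h1 : ((MpPsi.toRep (localSchrodingerDelta L e dV hdV dW hdW v)).comp sΔ) (h * k) =
      ((MpPsi.toRep (localSchrodingerDelta L e dV hdV dW hdW v)).comp sΔ) h * ((MpPsi.toRep (localSchrodingerDelta L e dV hdV dW hdW v)).comp sΔ) k :=
    MonoidHom.map_mul _ h k
  exact (congrArg (fun T : SchwartzBruhat (Fin (n + n) → v.adicCompletion (Fp L)) →ₗ[ℂ] SchwartzBruhat (Fin (n + n) → v.adicCompletion (Fp L)) => (T Φ : (Fin (n + n) → v.adicCompletion (Fp L)) → ℂ) 0) h1).trans rfl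

/-- **transport of the Siegel–Weil section**: for the transported splitting `s^Δ := mpTransportLoc Γ ∘ s`, `f^Δ_{Γ Φ}(h) = (Γ (ω_s(h) Φ))(0)` — the CM-model
section read through `Γ` (★ `MpPsi.toRep_congr_apply`). [cite: MoeglinVignerasWaldspurger1987, Chap. 2 I.7] [cite: KudlaRallis1994, §1] -/
theorem swSectionDelta_transport_apply (v : HeightOneSpectrum (𝓞 (Fp L)))
    (Γ : SchwartzBruhat (Fin (n + n) → v.adicCompletion (Fp L)) ≃ₗ[ℂ] SchwartzBruhat (Fin (n + n) → v.adicCompletion (Fp L)))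
    (hΓ : IsDeltaIntertwiner L e dV hdV dW hdW v Γ)
    (s : UnitaryGroup.localPi L (IsCMField.complexConj L) Nd J v →* LocalMp (Fp L) (n + n) (gramD L e dV hdV dW hdW) v)
    (Φ : SchwartzBruhat (Fin (n + n) → v.adicCompletion (Fp L))) (h : UnitaryGroup.localPi L (IsCMField.complexConj L) Nd J v) :
    swSectionDelta L e dV hdV dW hdW v ((mpTransportLoc L e dV hdV dW hdW v Γ hΓ).toMonoidHom.comp s) (Γ Φ) h =
      ((Γ (MpPsi.toRep (localSchrodinger (Fp L) (n + n) (gramD L e dV hdV dW hdW) v) (s h) Φ) : SchwartzBruhat (Fin (n + n) → v.adicCompletion (Fp L))) :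
        (Fin (n + n) → v.adicCompletion (Fp L)) → ℂ) 0 := by
  have h1 : MpPsi.toRep (localSchrodingerDelta L e dV hdV dW hdW v) (((mpTransportLoc L e dV hdV dW hdW v Γ hΓ).toMonoidHom.comp s) h) (Γ Φ) =
      Γ (MpPsi.toRep (localSchrodinger (Fp L) (n + n) (gramD L e dV hdV dW hdW) v) (s h) Φ) :=
    toRep_mpTransportLoc_apply L e dV hdV dW hdW v Γ hΓ (s h) Φ
  exact congrArg (fun F : SchwartzBruhat (Fin (n + n) → v.adicCompletion (Fp L)) => (F : (Fin (n + n) → v.adicCompletion (Fp L)) → ℂ) 0) h1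

end SW

end Summit.HodgeConjecture.HodgeConjecture.Cruxes.HLiu418.K2LiuDoublingSchrodingerModelDefs

end
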